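import Summits.HubbardSuperconductivity.HubbardSuperconductivity.Theorems.AposterioriCapRgDefs
import Literature.MathematicalPhysics.QuantumLattice.XYOrderDischarges
import Literature.MathematicalPhysics.QuantumLattice.GroundStateSourceBounds

/-!
# `XYOrderOpennessLargeSpin`, line `feynman-sector-gap`: energy localisation

Crux item stmt-HubbardSuperconductivity-13895 (route `AposterioriCapRg`), vocabulary of
`Theorems/AposterioriCapRgDefs.lean`. For `W = Σ_x w_x` a sum of Hermitian rules with spectrum in
`[-1, 1]` (`NormBoundedRuleSum`), `H = hpert L n W ε = xyTorus 2 L n + εW` on `(ℤ/Lℤ)²`, `L ≥ 3`,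
`S = n/2`, `ω` the tracial ground state of `H`, `C_H(q) = modeWeight L n H q`, `disp(p) = Σᵢ(1 - cos pᵢ)`:
`Σ_{q ≠ 0} disp(p_q) C_H(q) ≤ (n + 2|ε|) L⁴` — the reflection-positivity-free first-moment sum
rule of Kennedy–Lieb–Shastry (PRL 61 (1988) 2582, eqs. (3), (6)), made `ε`-robust: with the real
symmetric kernel `G(x,y) = Re ω(S⁰_xS⁰_y + S¹_xS¹_y)`, orthogonality of the characters of `(ℤ/Lℤ)²`
gives `Σ_q disp(p_q) C_H(q) = 2L² Σ_x G(x,x) + L² Re ω(xyTorus)`; then the single-site Casimir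
`G(x,x) ≤ S(S+1)` and the planar trial state `Re ω(xyTorus) = E₀ - ε Re ω(W) ≤ -2S²L² + 2|ε|L²`.
-/

noncomputable section

namespace Summit.HubbardSuperconductivity.HubbardSuperconductivity.Theorems.XYOrderOpennessLargeSpin

set_option linter.dupNamespace false -- summit = problem name (single-conjunct summit), D-0017

open Matrix Complex Finset
open scoped ComplexOrder
open Literature.MathematicalPhysics.QuantumLattice Literature.Probability.LatticeModels

/-- `e^{-i p·x} = conj χ_q(x)`, `χ_q(x) = ∏ⱼ e(qⱼ xⱼ)` the character of `(ℤ/Lℤ)²`. [folklore] -/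
private theorem exp_neg_phase_eq_star (L : ℕ) [NeZero L] (q x : TorusSite 2 L) :
    cexp (-(I * (torusPhase L q x : ℂ))) = star (∏ j, (ZMod.stdAddChar (q j * x j) : ℂ)) := by
  rw [torusChar_eq_exp, Complex.star_def, ← Complex.exp_conj, map_mul, Complex.conj_ofReal,
    Complex.conj_I]
  congr 1
  ring

/-- `(Ŝ^α_q)ᴴ = Σ_x χ_q(x) S^α_x`. [folklore] -/
private theorem spinMode_conjTranspose (L : ℕ) [NeZero L] (n : ℕ) (q : TorusSite 2 L)
    (α : Fin 3) :
    (spinMode L n q α)ᴴ = ∑ x, (∏ j, (ZMod.stdAddChar (q j * x j) : ℂ)) • siteSpin n x α := by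
  unfold spinMode
  rw [conjTranspose_sum]
  refine sum_congr rfl fun x _ => ?_
  rw [conjTranspose_smul, (siteSpin_isHermitian n x α).eq, exp_neg_phase_eq_star, star_star]

/-- `(Ŝ^α_q)ᴴ Ŝ^α_q = Σ_{x,y} χ_q(x - y) S^α_x S^α_y`. [folklore] -/
private theorem spinMode_conjTranspose_mul (L : ℕ) [NeZero L] (n : ℕ) (q : TorusSite 2 L)
    (α : Fin 3) :
    (spinMode L n q α)ᴴ * spinMode L n q α =
      ∑ x, ∑ y, (∏ j, (ZMod.stdAddChar (q j * (x - y) j) : ℂ)) •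
        (siteSpin n x α * siteSpin n y α) := by
  rw [spinMode_conjTranspose]
  unfold spinMode
  rw [sum_mul_sum]
  refine sum_congr rfl fun x _ => sum_congr rfl fun y _ => ?_
  rw [smul_mul_smul_comm, exp_neg_phase_eq_star, ← torusChar_neg, ← torusChar_add,
    sub_eq_add_neg]

section Kernel

variable {Λ : Type*} [Fintype Λ] [DecidableEq Λ]

/-- Spins at any two sites commute within one component: `S^α_y S^α_x = S^α_x S^α_y`. [folklore] -/
private theorem siteSpin_mul_siteSpin_comm (n : ℕ) (α : Fin 3) (x y : Λ) :
    (siteSpin n y α * siteSpin n x α : Op Λ (n + 1)) = siteSpin n x α * siteSpin n y α := by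
  by_cases hxy : x = y
  · rw [hxy]
  · exact (siteSpin_commute_of_ne_holds n hxy α α).eq.symm

/-- `ω(S^α_x S^α_y)` is real (`S^α_x S^α_y` is Hermitian). [folklore] -/
private theorem gsf_siteSpin_mul_im (n : ℕ) (A : Op Λ (n + 1)) (α : Fin 3) (x y : Λ) :
    (A.groundStateFunctional (siteSpin n x α * siteSpin n y α)).im = 0 := by
  have h := groundStateFunctional_conjTranspose A (siteSpin n x α * siteSpin n y α)
  rw [conjTranspose_mul, (siteSpin_isHermitian n x α).eq, (siteSpin_isHermitian n y α).eq,
    siteSpin_mul_siteSpin_comm] at h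
  rw [← Complex.conj_eq_iff_im]
  exact h.symm

/-- `Re ω(b^α_{xy}) = G^α(x,y)` for the symmetrised bond `b^α_{xy} = ½(S^α_x S^α_y + S^α_y S^α_x)`.
[folklore] -/
private theorem re_gsf_spinBond (n : ℕ) (A : Op Λ (n + 1)) (α : Fin 3) (x y : Λ) :
    (A.groundStateFunctional (spinBond n α x y)).re =
      (A.groundStateFunctional (siteSpin n x α * siteSpin n y α)).re := by
  rw [spinBond, siteSpin_mul_siteSpin_comm, ← two_smul ℂ, smul_smul,
    show (1 / 2 : ℂ) * 2 = 1 by norm_num, one_smul]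

/-- The single-site Casimir in the plane: `(S⁰_x)² + (S¹_x)² = S(S+1)·1 - (S²_x)²`.
[cite: Tasaki2020, §2.1 eq. (2.1.2)] -/
private theorem siteSpin_sq_add_siteSpin_sq (n : ℕ) (x : Λ) :
    (siteSpin n x 0 * siteSpin n x 0 + siteSpin n x 1 * siteSpin n x 1 : Op Λ (n + 1)) =
      ((n : ℂ) / 2 * ((n : ℂ) / 2 + 1)) • (1 : Op Λ (n + 1)) - siteSpin n x 2 * siteSpin n x 2 := by
  have hC : spinVec n 0 * spinVec n 0 + spinVec n 1 * spinVec n 1 + spinVec n 2 * spinVec n 2 =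
      ((n : ℂ) / 2 * ((n : ℂ) / 2 + 1)) • (1 : Matrix (Fin (n + 1)) (Fin (n + 1)) ℂ) := by
    have h := spinCasimir_eq_holds n
    unfold spinCasimir_eq spinCasimir at h
    rwa [Fin.sum_univ_three] at h
  unfold siteSpin
  rw [onSite_mul, onSite_mul, onSite_mul, ← onSite_add', eq_sub_of_add_eq hC, onSite_sub',
    onSite_smul', onSite_one']

/-- `G(x,x) = Re ω((S⁰_x)² + (S¹_x)²) ≤ S(S+1)` for the tracial ground state of a Hermitian `A`.
[folklore] -/
private theorem re_gsf_inplane_sq_le [Nonempty Λ] (n : ℕ) {A : Op Λ (n + 1)} (hA : A.IsHermitian)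
    (x : Λ) :
    (A.groundStateFunctional (siteSpin n x 0 * siteSpin n x 0 + siteSpin n x 1 * siteSpin n x 1)).re ≤
      (n : ℝ) / 2 * ((n : ℝ) / 2 + 1) := by
  have hpos := groundStateFunctional_nonneg A (siteSpin n x 2)
  rw [(siteSpin_isHermitian n x 2).eq] at hpos
  obtain ⟨hre, -⟩ := Complex.nonneg_iff.mp hpos
  rw [siteSpin_sq_add_siteSpin_sq, map_sub, map_smul, groundStateFunctional_one hA, smul_eq_mul,
    mul_one, Complex.sub_re,
    show ((n : ℂ) / 2 * ((n : ℂ) / 2 + 1)) = (((n : ℝ) / 2 * ((n : ℝ) / 2 + 1) : ℝ) : ℂ) by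
      push_cast; ring, Complex.ofReal_re]
  linarith

end Kernel

/-- **Cosine form of the mode weight**: `Re ω((Ŝ^α_q)ᴴ Ŝ^α_q) = Σ_{x,y} cos(p_q·(x-y)) G^α(x,y)`.
[cite: KLS1988PRL, eq. (2)] -/
private theorem re_gsf_spinMode (L : ℕ) [NeZero L] (n : ℕ) (A : Op (TorusSite 2 L) (n + 1))
    (q : TorusSite 2 L) (α : Fin 3) :
    (A.groundStateFunctional ((spinMode L n q α)ᴴ * spinMode L n q α)).re =
      ∑ x : TorusSite 2 L, ∑ y : TorusSite 2 L, Real.cos (torusPhase L q (x - y)) *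
        (A.groundStateFunctional (siteSpin n x α * siteSpin n y α)).re := by
  rw [spinMode_conjTranspose_mul, map_sum, Complex.re_sum]
  refine sum_congr rfl fun x _ => ?_
  rw [map_sum, Complex.re_sum]
  refine sum_congr rfl fun y _ => ?_
  rw [map_smul, smul_eq_mul, Complex.mul_re, gsf_siteSpin_mul_im, mul_zero, sub_zero, torusChar_re]

/-- **Parseval**: `Σ_q Re ω((Ŝ^α_q)ᴴ Ŝ^α_q) = L² Σ_x G^α(x,x)`. [cite: KLS1988PRL, eq. (2)] -/
private theorem sum_re_gsf_spinMode (L : ℕ) [NeZero L] (n : ℕ) (A : Op (TorusSite 2 L) (n + 1))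
    (α : Fin 3) :
    ∑ q : TorusSite 2 L, (A.groundStateFunctional ((spinMode L n q α)ᴴ * spinMode L n q α)).re =
      (L : ℝ) ^ 2 * ∑ x : TorusSite 2 L,
        (A.groundStateFunctional (siteSpin n x α * siteSpin n x α)).re := by
  simp_rw [re_gsf_spinMode]
  calc ∑ q : TorusSite 2 L, ∑ x : TorusSite 2 L, ∑ y : TorusSite 2 L,
        Real.cos (torusPhase L q (x - y)) *
          (A.groundStateFunctional (siteSpin n x α * siteSpin n y α)).re
      = ∑ x : TorusSite 2 L, ∑ y : TorusSite 2 L,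
          (∑ q : TorusSite 2 L, Real.cos (torusPhase L q (x - y))) *
            (A.groundStateFunctional (siteSpin n x α * siteSpin n y α)).re := by
        rw [sum_comm]
        refine sum_congr rfl fun x _ => ?_
        rw [sum_comm]
        refine sum_congr rfl fun y _ => ?_
        rw [sum_mul]
    _ = ∑ x : TorusSite 2 L, (L : ℝ) ^ 2 *
          (A.groundStateFunctional (siteSpin n x α * siteSpin n x α)).re := by
        refine sum_congr rfl fun x _ => ?_
        simp_rw [sum_cos_torusPhase, sub_eq_zero, ite_mul, zero_mul]
        rw [sum_ite_eq]
        simp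
    _ = _ := by rw [← mul_sum]

/-- **First-moment Fourier identity**: `Σ_q Re ω((Ŝ^α_q)ᴴ Ŝ^α_q) cos (p_q)ᵢ = L² Σ_x G^α(x, x + eᵢ)`.
[cite: KLS1988PRL, eqs. (3), (6)] -/
private theorem sum_re_gsf_spinMode_mul_cos (L : ℕ) [NeZero L] (n : ℕ)
    (A : Op (TorusSite 2 L) (n + 1)) (α : Fin 3) (i : Fin 2) :
    ∑ q : TorusSite 2 L, (A.groundStateFunctional ((spinMode L n q α)ᴴ * spinMode L n q α)).re *
        Real.cos (latticeMomentum L q i) =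
      (L : ℝ) ^ 2 * ∑ x : TorusSite 2 L,
        (A.groundStateFunctional (siteSpin n x α * siteSpin n (x + Pi.single i 1) α)).re := by
  simp_rw [re_gsf_spinMode]
  exact sum_structureFactor_mul_cos L
    (fun x y => (A.groundStateFunctional (siteSpin n x α * siteSpin n y α)).re)
    (fun x y => by rw [siteSpin_mul_siteSpin_comm n α x y]) i

section Loewner

open scoped MatrixOrder

/-- `1 - w ≥ 0` if the Hermitian `w` has all eigenvalues `≤ 1` in absolute value. [folklore] -/
private theorem posSemidef_one_sub_of_eig {m : Type*} [Fintype m] [DecidableEq m]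
    {w : Matrix m m ℂ} (hw : w.IsHermitian) (h : ∀ i, |hw.eigenvalues i| ≤ 1) :
    (1 - w).PosSemidef := by
  have hle : w ≤ algebraMap ℝ (Matrix m m ℂ) 1 := by
    rw [le_algebraMap_iff_spectrum_le (ha := hw.isSelfAdjoint)]
    intro x hx
    rw [hw.spectrum_real_eq_range_eigenvalues] at hx
    obtain ⟨i, rfl⟩ := hx
    exact (abs_le.1 (h i)).2
  rw [map_one] at hle
  exact Matrix.le_iff.1 hle

/-- `1 + w ≥ 0` if the Hermitian `w` has all eigenvalues `≤ 1` in absolute value. [folklore] -/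
private theorem posSemidef_one_add_of_eig {m : Type*} [Fintype m] [DecidableEq m]
    {w : Matrix m m ℂ} (hw : w.IsHermitian) (h : ∀ i, |hw.eigenvalues i| ≤ 1) :
    (1 + w).PosSemidef := by
  have hle : algebraMap ℝ (Matrix m m ℂ) (-1) ≤ w := by
    rw [algebraMap_le_iff_le_spectrum (ha := hw.isSelfAdjoint)]
    intro x hx
    rw [hw.spectrum_real_eq_range_eigenvalues] at hx
    obtain ⟨i, rfl⟩ := hx
    exact (abs_le.1 (h i)).1
  rw [map_neg, map_one] at hle
  have h' := Matrix.le_iff.1 hle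
  rwa [sub_neg_eq_add, add_comm] at h'

/-- `|Re ω_A(w)| ≤ 1` for `-1 ≤ w ≤ 1` and the tracial ground state of a Hermitian `A`. [folklore] -/
private theorem abs_re_gsf_le_one {m : Type*} [Fintype m] [DecidableEq m] [Nonempty m]
    {A w : Matrix m m ℂ} (hA : A.IsHermitian) (hw : w.IsHermitian)
    (h : ∀ i, |hw.eigenvalues i| ≤ 1) : |(A.groundStateFunctional w).re| ≤ 1 := by
  have hone := groundStateFunctional_one hA
  have h1 := groundStateFunctional_nonneg_of_posSemidef A (posSemidef_one_sub_of_eig hw h)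
  have h2 := groundStateFunctional_nonneg_of_posSemidef A (posSemidef_one_add_of_eig hw h)
  rw [map_sub, hone] at h1
  rw [map_add, hone] at h2
  obtain ⟨h1, -⟩ := Complex.nonneg_iff.mp h1
  obtain ⟨h2, -⟩ := Complex.nonneg_iff.mp h2
  rw [Complex.sub_re, Complex.one_re] at h1
  rw [Complex.add_re, Complex.one_re] at h2
  rw [abs_le]
  constructor <;> linarith

/-- `|Re ⟨ψ, w ψ⟩| ≤ 1` for `-1 ≤ w ≤ 1` and a unit vector `ψ`. [folklore] -/
private theorem abs_re_rayleigh_le_one {m : Type*} [Fintype m] [DecidableEq m]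
    {w : Matrix m m ℂ} (hw : w.IsHermitian) (h : ∀ i, |hw.eigenvalues i| ≤ 1) (ψ : m → ℂ)
    (hψ : star ψ ⬝ᵥ ψ = 1) : |(star ψ ⬝ᵥ w *ᵥ ψ).re| ≤ 1 := by
  have h1 := (posSemidef_one_sub_of_eig hw h).dotProduct_mulVec_nonneg ψ
  have h2 := (posSemidef_one_add_of_eig hw h).dotProduct_mulVec_nonneg ψ
  rw [sub_mulVec, dotProduct_sub, one_mulVec, hψ] at h1
  rw [add_mulVec, dotProduct_add, one_mulVec, hψ] at h2
  obtain ⟨h1, -⟩ := Complex.nonneg_iff.mp h1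
  obtain ⟨h2, -⟩ := Complex.nonneg_iff.mp h2
  rw [Complex.sub_re, Complex.one_re] at h1
  rw [Complex.add_re, Complex.one_re] at h2
  rw [abs_le]
  constructor <;> linarith

end Loewner

/-- **Energy localisation** (stub `stub_energyLocalisation` of the line `feynman-sector-gap`). For
`W = Σ_x w_x` with Hermitian rules of spectrum in `[-1,1]` and `H = xyTorus 2 L n + εW` (`L ≥ 3`,
`S = n/2`): `Σ_{q ≠ 0} disp(p_q) C_H(q) ≤ (n + 2|ε|) L⁴`, through the Fourier identity
`Σ_q disp(p_q) C_H(q) = 2L² Σ_x Re ω((S⁰_x)² + (S¹_x)²) + L² Re ω(xyTorus 2 L n)`, the single-site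
Casimir `(S⁰)² + (S¹)² ≤ S(S+1)`, and `Re ω(xyTorus) = E₀ - ε Re ω(W) ≤ -2S²L² + 2|ε|L²` (planar
trial state, `|Re ω(W)| ≤ L²`). [cite: KLS1988PRL, eqs. (3), (6)] -/
theorem stub_energyLocalisation :
    ∀ (n L : ℕ) [NeZero L], 1 ≤ n → 3 ≤ L → ∀ (W : Op (TorusSite 2 L) (n + 1)) (ε : ℝ),
      NormBoundedRuleSum n L W →
      ∑ q ∈ (univ : Finset (TorusSite 2 L)).erase 0,
          dispersion (latticeMomentum L q) * modeWeight L n (hpert L n W ε) q ≤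
        ((n : ℝ) + 2 * |ε|) * (L : ℝ) ^ 4 := by
  intro n L _ _hn hL W ε hNB
  obtain ⟨w, hWsum, hw⟩ := hNB
  have hL2 : 2 ≤ L := by omega
  have hL2' : L ≠ 2 := by omega
  -- Hermiticity
  have hWh : W.IsHermitian := by
    rw [hWsum, Matrix.IsHermitian, conjTranspose_sum]
    exact sum_congr rfl fun x _ => (hw x).choose.eq
  set H : Op (TorusSite 2 L) (n + 1) := hpert L n W ε with hHdef
  have hH : H.IsHermitian := by
    rw [hHdef, hpert]
    refine (xyTorus_isHermitian 2 L n).add ?_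
    unfold Matrix.IsHermitian
    rw [conjTranspose_smul, hWh.eq, Complex.star_def, Complex.conj_ofReal]
  set ω := H.groundStateFunctional with hω
  -- cardinalities: `|Λ| = L²`, `#E = 2L²`
  set E := (torusGraph 2 L).edgeFinset with hE
  have hcardT : (Fintype.card (TorusSite 2 L) : ℝ) = (L : ℝ) ^ 2 := by
    rw [Fintype.card_pi, prod_const, ZMod.card, card_univ, Fintype.card_fin]
    push_cast
    ring
  have hcardE : (E.card : ℝ) = 2 * (L : ℝ) ^ 2 := by
    have h5 := sum_pairs_eq_sum_edgeFinset (d := 2) L hL2 (fun _ => (1 : ℝ))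
    simp only [sum_const, card_univ, nsmul_eq_mul, mul_one, Fintype.card_fin, if_neg hL2',
      one_mul] at h5
    rw [← hE] at h5; rw [← hcardT]
    push_cast at h5 ⊢
    linarith
  -- (1) `|Re ω(W)| ≤ L²`
  have hωW : |(ω W).re| ≤ (L : ℝ) ^ 2 := by
    rw [hWsum, map_sum, Complex.re_sum]
    refine (abs_sum_le_sum_abs _ _).trans ?_
    calc ∑ x : TorusSite 2 L, |(ω (w x)).re| ≤ ∑ x : TorusSite 2 L, (1 : ℝ) :=
          sum_le_sum fun x _ => abs_re_gsf_le_one hH (hw x).choose (hw x).choose_spec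
      _ = (L : ℝ) ^ 2 := by rw [sum_const, card_univ, nsmul_eq_mul, mul_one, hcardT]
  -- (2) the planar trial state: `E₀ ≤ -2 S² L² + |ε| L²`
  have htrial : H.groundEnergy ≤ -(2 * ((n : ℝ) / 2) ^ 2 * (L : ℝ) ^ 2) + |ε| * (L : ℝ) ^ 2 := by
    obtain ⟨V, hV, hV', hVz, -, hVy⟩ := exists_unitary_conj_spinZ_eq_spinX n
    set U : Op (TorusSite 2 L) (n + 1) := productOp (fun _ : TorusSite 2 L => Vᴴ) with hU
    have hUU : U * Uᴴ = 1 :=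
      productOp_mul_conjTranspose fun _ => by rw [conjTranspose_conjTranspose, hV']
    set v : TensorIndex (TorusSite 2 L) (n + 1) → ℂ := Pi.single (fun _ => 0) 1 with hv
    have hstar : star v = v := by rw [hv, ← Pi.single_star, star_one]
    set ψ := Uᴴ *ᵥ v with hψdef
    have hψ : star ψ ⬝ᵥ ψ = 1 := by
      rw [hψdef, star_mulVec, conjTranspose_conjTranspose, ← dotProduct_mulVec, mulVec_mulVec, hUU,
        one_mulVec, hstar, hv, single_dotProduct, Pi.single_eq_same, one_mul]
    have hray := groundEnergy_le_rayleigh_holds hH ψ hψ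
    have hxyψ : star ψ ⬝ᵥ xyTorus 2 L n *ᵥ ψ =
        -((((n : ℂ) / 2) ^ 2) * (E.card : ℂ)) := by
      rw [hψdef, star_mulVec, conjTranspose_conjTranspose, ← dotProduct_mulVec, mulVec_mulVec,
        mulVec_mulVec, hstar, hv, single_dotProduct, one_mul, mulVec_single_one, Matrix.col_apply,
        hU, xyTorus_trialEnergy L n hV hV' hVz hVy]
    have hWψ : |(star ψ ⬝ᵥ W *ᵥ ψ).re| ≤ (L : ℝ) ^ 2 := by
      rw [hWsum, sum_mulVec, dotProduct_sum, Complex.re_sum]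
      refine (abs_sum_le_sum_abs _ _).trans ?_
      calc ∑ x : TorusSite 2 L, |(star ψ ⬝ᵥ w x *ᵥ ψ).re| ≤ ∑ x : TorusSite 2 L, (1 : ℝ) :=
            sum_le_sum fun x _ => abs_re_rayleigh_le_one (hw x).choose (hw x).choose_spec ψ hψ
        _ = (L : ℝ) ^ 2 := by rw [sum_const, card_univ, nsmul_eq_mul, mul_one, hcardT]
    have hsplit : (star ψ ⬝ᵥ H *ᵥ ψ).re =
        -(((n : ℝ) / 2) ^ 2 * (2 * (L : ℝ) ^ 2)) + ε * (star ψ ⬝ᵥ W *ᵥ ψ).re := by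
      rw [hHdef, hpert, add_mulVec, dotProduct_add, smul_mulVec, dotProduct_smul, smul_eq_mul,
        hxyψ, Complex.add_re, Complex.re_ofReal_mul, ← hcardE, Complex.neg_re,
        show (((n : ℂ) / 2) ^ 2 * (E.card : ℂ)) = ((((n : ℝ) / 2) ^ 2 * (E.card : ℝ) : ℝ) : ℂ) by
          push_cast; ring, Complex.ofReal_re]
    rw [hsplit] at hray
    have hεW : ε * (star ψ ⬝ᵥ W *ᵥ ψ).re ≤ |ε| * (L : ℝ) ^ 2 := (le_abs_self _).trans
      ((abs_mul _ _).le.trans (mul_le_mul_of_nonneg_left hWψ (abs_nonneg ε)))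
    linarith
  -- (3) `E₀ = Re ω(H) = Re ω(xyTorus) + ε Re ω(W)`, hence `Re ω(xyTorus) ≤ -2S²L² + 2|ε|L²`
  have hE0 : H.groundEnergy = (ω (xyTorus 2 L n)).re + ε * (ω W).re := by
    have h := congrArg Complex.re (groundStateFunctional_hamiltonian hH)
    rw [Complex.ofReal_re] at h
    rw [← h, ← hω]
    conv_lhs => rw [hHdef, hpert]
    rw [map_add, map_smul, smul_eq_mul, Complex.add_re, Complex.re_ofReal_mul]
  have hεω : |ε * (ω W).re| ≤ |ε| * (L : ℝ) ^ 2 :=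
    (abs_mul _ _).le.trans (mul_le_mul_of_nonneg_left hωW (abs_nonneg ε))
  have hxyle : (ω (xyTorus 2 L n)).re ≤
      -(2 * ((n : ℝ) / 2) ^ 2 * (L : ℝ) ^ 2) + 2 * (|ε| * (L : ℝ) ^ 2) := by
    linarith [neg_abs_le (ε * (ω W).re)]
  -- (4) the two-point kernel and the bond sum: `Re ω(xyTorus) = -Σ_x Σ_i G(x, x + eᵢ)`
  set g : Fin 3 → TorusSite 2 L → TorusSite 2 L → ℝ :=
    fun α x y => (ω (siteSpin n x α * siteSpin n y α)).re with hg
  set b : Sym2 (TorusSite 2 L) → Op (TorusSite 2 L) (n + 1) :=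
    Sym2.lift ⟨fun x y => spinBond n 0 x y + spinBond n 1 x y + ((0 : ℝ) : ℂ) • spinBond n 2 x y,
      fun x y => by simp only [spinBond_comm]⟩ with hb
  have hxyT : xyTorus 2 L n = ((-1 : ℝ) : ℂ) • ∑ e ∈ E, b e := rfl
  have hbond : ∀ x y : TorusSite 2 L, (ω (b s(x, y))).re = g 0 x y + g 1 x y := by
    intro x y
    rw [hb, Sym2.lift_mk, map_add, map_add, map_smul, Complex.ofReal_zero, zero_smul, add_zero,
      Complex.add_re, hg, hω, re_gsf_spinBond, re_gsf_spinBond]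
  have hxyω : (ω (xyTorus 2 L n)).re =
      -∑ x : TorusSite 2 L, ∑ i : Fin 2, (g 0 x (x + Pi.single i 1) + g 1 x (x + Pi.single i 1)) := by
    rw [hxyT, map_smul, smul_eq_mul, Complex.re_ofReal_mul, map_sum, Complex.re_sum]
    have hpairs := sum_pairs_eq_sum_edgeFinset (d := 2) L hL2 (fun e => (ω (b e)).re)
    rw [if_neg hL2', one_mul, ← hE] at hpairs
    rw [← hpairs]
    simp_rw [hbond]
    ring
  -- (5) the Fourier identity: `Σ_q disp(p_q) C(q) = 2L² Σ_x G(x,x) + L² Re ω(xyTorus)`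
  have key : ∀ i : Fin 2,
      ∑ q : TorusSite 2 L, (1 - Real.cos (latticeMomentum L q i)) * modeWeight L n H q =
        (L : ℝ) ^ 2 * (∑ x, g 0 x x + ∑ x, g 1 x x) -
          (L : ℝ) ^ 2 * (∑ x, g 0 x (x + Pi.single i 1) + ∑ x, g 1 x (x + Pi.single i 1)) := by
    intro i
    have h1 : ∀ q : TorusSite 2 L, (1 - Real.cos (latticeMomentum L q i)) * modeWeight L n H q =
        ((ω ((spinMode L n q 0)ᴴ * spinMode L n q 0)).re +
          (ω ((spinMode L n q 1)ᴴ * spinMode L n q 1)).re) -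
        ((ω ((spinMode L n q 0)ᴴ * spinMode L n q 0)).re * Real.cos (latticeMomentum L q i) +
          (ω ((spinMode L n q 1)ᴴ * spinMode L n q 1)).re * Real.cos (latticeMomentum L q i)) := by
      intro q
      unfold modeWeight
      rw [hω, map_add, Complex.add_re]
      ring
    simp_rw [h1]
    rw [sum_sub_distrib, sum_add_distrib, sum_add_distrib, hω, sum_re_gsf_spinMode,
      sum_re_gsf_spinMode, sum_re_gsf_spinMode_mul_cos, sum_re_gsf_spinMode_mul_cos, hg]
    ring
  have hident : ∑ q : TorusSite 2 L, dispersion (latticeMomentum L q) * modeWeight L n H q =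
      2 * (L : ℝ) ^ 2 * ∑ x, (g 0 x x + g 1 x x) + (L : ℝ) ^ 2 * (ω (xyTorus 2 L n)).re := by
    unfold dispersion
    simp_rw [sum_mul]
    rw [sum_comm, Fin.sum_univ_two, key, key, hxyω]
    simp_rw [Fin.sum_univ_two, sum_add_distrib]
    ring
  -- (6) the `q = 0` term vanishes (`disp(p_0) = 0`)
  have h0 : dispersion (latticeMomentum L (0 : TorusSite 2 L)) * modeWeight L n H 0 = 0 := by
    simp [dispersion, latticeMomentum_apply]
  rw [sum_erase (f := fun q => dispersion (latticeMomentum L q) * modeWeight L n H q) univ h0, hident]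
  -- (7) the Casimir bound and the arithmetic
  have hCas : ∑ x : TorusSite 2 L, (g 0 x x + g 1 x x) ≤
      (L : ℝ) ^ 2 * ((n : ℝ) / 2 * ((n : ℝ) / 2 + 1)) := by
    calc ∑ x : TorusSite 2 L, (g 0 x x + g 1 x x)
        ≤ ∑ _x : TorusSite 2 L, (n : ℝ) / 2 * ((n : ℝ) / 2 + 1) := by
          refine sum_le_sum fun x _ => ?_
          have h := re_gsf_inplane_sq_le n hH x
          rw [map_add, Complex.add_re] at h
          simpa only [hg, hω] using h
      _ = (L : ℝ) ^ 2 * ((n : ℝ) / 2 * ((n : ℝ) / 2 + 1)) := by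
          rw [sum_const, card_univ, nsmul_eq_mul, hcardT]
  have hL2nn : (0 : ℝ) ≤ (L : ℝ) ^ 2 := by positivity
  calc 2 * (L : ℝ) ^ 2 * ∑ x, (g 0 x x + g 1 x x) + (L : ℝ) ^ 2 * (ω (xyTorus 2 L n)).re
      ≤ 2 * (L : ℝ) ^ 2 * ((L : ℝ) ^ 2 * ((n : ℝ) / 2 * ((n : ℝ) / 2 + 1))) +
          (L : ℝ) ^ 2 * (-(2 * ((n : ℝ) / 2) ^ 2 * (L : ℝ) ^ 2) + 2 * (|ε| * (L : ℝ) ^ 2)) := by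
        gcongr
    _ = ((n : ℝ) + 2 * |ε|) * (L : ℝ) ^ 4 := by ring

end Summit.HubbardSuperconductivity.HubbardSuperconductivity.Theorems.XYOrderOpennessLargeSpin

end
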